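import Summits.ABC.ABC.Theorems.TwistAmplificationMazurKaneLawDEFibreZ
import Summits.ABC.ABC.Theorems.TwistAmplificationMazurKaneLawDECauchySchwarzSum
import Summits.ABC.ABC.Theorems.TwistAmplificationMazurKaneLawDELinEnergy
import Summits.ABC.ABC.Theorems.TwistAmplificationMazurKaneLawDEEnergySum

-- Summit.ABC.ABC is the mandated summit-side namespace (single-conjunct summit); the lakefile sets the same option tree-wide.
set_option linter.dupNamespace false

/-!
# The DE tool with host the `z`-term (crux stmt-ABC-2757, stub `de_dispersionToolZ`)

Assembly of the "DE tool" (dispersion / energy) for the line `critical-kloosterman-powerful-moduli`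
of the crux `Summit.ABC.ABC.Theses.TwistAmplification.MazurKaneLaw`, in the variant where the host
modulus `q = W_Q(z) = ∏_{i∈Q} zᵢ^{i+1}` (`AbcShapes.onVal Q z`) is read off the `z`-term of
`c₁ V(x) + c₂ V(y) = c₃ V(z)` and the counted pair is `(x, y)` (SUM form of the congruence
`q ∣ c₁ V(x) + c₂ V(y)`).  `Summit.ABC.ABC.Theorems.MazurKaneLaw.de_dispersionToolZ` bounds the
square of the shape count `B = AbcShapes.shapeCount c₁ c₂ c₃ X Y Z` by
`4400 Dτ^{6d+8} (X₀Y₀) max(1, X₀Y₀/q₀) NQ (T₁ + T₂ + T₃ + T₄)`, `X₀ = X_{i₀}`, `Y₀ = Y_{i₀}`,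
`q₀ = W_Q(Z)`, `NQ = #subBox Qᶜ Z`, with `T₁, …, T₄` the four terms of the multiplicative-energy
bound `de_energy_sum_le` (host `Z`, sides `X, Y`).

The proof is pure bookkeeping of four landed lemmas:
* `de_shapeCount_le_fibre_hostZ`: `B ≤ Dτ^d #F`, `F` the admissible `((x, y), r)`,
  `r ∈ subBox Qᶜ Z`;
* fibring `F` over `r` (`de_toolZ_card_filter_prod_le`): `#F ≤ Σ_r #F_r`;
* `de_fibre_card_le_sqrt_sum` (ratio Cauchy–Schwarz modulo `q(r) = W_Q(r)`):
  `#F_r ≤ √E_lin(q(r)) √R_{q(r)}`, and `de_linRatioEnergy_le`: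
  `E_lin(q) ≤ Dτ 4X₀Y₀ (8X₀Y₀/q + 3) ≤ 44 Dτ X₀Y₀ max(1, X₀Y₀/q₀) =: Ē` (`q₀ ≤ q`);
* Cauchy–Schwarz over `r`: `(Σ_r √R_r)² ≤ NQ Σ_r R_r`, and `de_energy_sum_le`:
  `Σ_r R_r ≤ 100 Dτ^{4d+7} (T₁ + ⋯ + T₄)`;
so that `B² ≤ Dτ^{2d} Ē NQ · 100 Dτ^{4d+7} (T₁ + ⋯ + T₄)`, which is the claim.
No new definitions; everything here is folklore bookkeeping.
-/

namespace Summit.ABC.ABC.Theorems.MazurKaneLaw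

open Finset
open Literature.NumberTheory.DiophantineGeometry
open Literature.NumberTheory.DiophantineGeometry.AbcShapes

/-- Fibring a filtered product over its second factor:
`#{(a, b) ∈ s × t : P (a, b)} = Σ_{b ∈ t} #{a ∈ s : P (a, b)}`. [folklore] -/
theorem de_toolZ_card_filter_prod {α β : Type*} (s : Finset α) (t : Finset β)
    (P : α × β → Prop) [DecidablePred P] :
    ((s ×ˢ t).filter P).card = ∑ b ∈ t, (s.filter (fun a => P (a, b))).card := by
  rw [card_filter, sum_product_right]
  refine sum_congr rfl fun b _ => ?_
  rw [card_filter]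

/-- Fibring a filtered product over its second factor, real-valued inequality form:
`#{(a, b) ∈ s × t : P (a, b)} ≤ Σ_{b ∈ t} #{a ∈ s : P (a, b)}` in `ℝ`. [folklore] -/
theorem de_toolZ_card_filter_prod_le {α β : Type*} (s : Finset α) (t : Finset β)
    (P : α × β → Prop) [DecidablePred P] :
    ((((s ×ˢ t).filter P).card : ℕ) : ℝ) ≤
      ∑ b ∈ t, (((s.filter (fun a => P (a, b))).card : ℕ) : ℝ) := by
  rw [de_toolZ_card_filter_prod, Nat.cast_sum]

/-- Abstract assembly of the DE tool: from `Σᵢ Rᵢ ≤ K C`, `B ≤ D F`, `F ≤ Σᵢ Fᵢ` and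
`Fᵢ ≤ √E √Rᵢ` (`Rᵢ, B, D, E ≥ 0`) one gets `B² ≤ D² E #s (K C)`, by Cauchy–Schwarz
`(Σᵢ √Rᵢ)² ≤ #s Σᵢ Rᵢ`. [folklore] -/
theorem de_toolZ_assemble {ι : Type*} {s : Finset ι} {R : ι → ℝ} {K C B D F E : ℝ} {Fr : ι → ℝ}
    (hsum : ∑ i ∈ s, R i ≤ K * C) (hB : B ≤ D * F) (hF : F ≤ ∑ i ∈ s, Fr i)
    (hFr : ∀ i ∈ s, Fr i ≤ Real.sqrt E * Real.sqrt (R i)) (hR : ∀ i ∈ s, 0 ≤ R i)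
    (hB0 : 0 ≤ B) (hD : 0 ≤ D) (hE : 0 ≤ E) :
    B ^ 2 ≤ D ^ 2 * E * (s.card : ℝ) * (K * C) := by
  have h1 : B ≤ D * (Real.sqrt E * ∑ i ∈ s, Real.sqrt (R i)) := by
    refine hB.trans (mul_le_mul_of_nonneg_left (hF.trans ?_) hD)
    rw [mul_sum]
    exact sum_le_sum hFr
  have h2 : (∑ i ∈ s, Real.sqrt (R i)) ^ 2 ≤ (s.card : ℝ) * ∑ i ∈ s, R i := by
    refine (sq_sum_le_card_mul_sum_sq (s := s) (f := fun i => Real.sqrt (R i))).trans_eq ?_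
    refine congrArg _ (sum_congr rfl fun i hi => ?_)
    exact Real.sq_sqrt (hR i hi)
  calc B ^ 2 ≤ (D * (Real.sqrt E * ∑ i ∈ s, Real.sqrt (R i))) ^ 2 := pow_le_pow_left₀ hB0 h1 2
    _ = D ^ 2 * E * (∑ i ∈ s, Real.sqrt (R i)) ^ 2 := by
        rw [mul_pow, mul_pow, Real.sq_sqrt hE]; ring
    _ ≤ D ^ 2 * E * ((s.card : ℝ) * ∑ i ∈ s, R i) :=
        mul_le_mul_of_nonneg_left h2 (by positivity)
    _ ≤ D ^ 2 * E * ((s.card : ℝ) * (K * C)) :=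
        mul_le_mul_of_nonneg_left (mul_le_mul_of_nonneg_left hsum (Nat.cast_nonneg _))
          (by positivity)
    _ = D ^ 2 * E * (s.card : ℝ) * (K * C) := by ring

/-- **The DE tool, host the `z`-term** (registered stub `de_dispersionToolZ`, line
`critical-kloosterman-powerful-moduli` of crux stmt-ABC-2757).  For positive `cᵢ`, dyadic boxes
with positive corners `X, Y, Z`, `cᵢ V(2·corner) ≤ T`, `τ(m) ≤ Dτ` for `0 < m ≤ 8T³`, the linear
coordinate `i₀ = 0`, the quadratic coordinate `i₁ = 1` and a level set `Q`:
`B² ≤ 4400 Dτ^{6d+8} (X₀Y₀) max(1, X₀Y₀/W_Q(Z)) NQ (T₁ + T₂ + T₃ + T₄)` with `NQ = #subBox Qᶜ Z`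
and `T₁, …, T₄` the four terms of `de_energy_sum_le` for host `Z` and sides `X, Y`.
Proof: `de_shapeCount_le_fibre_hostZ`, fibring over the host tuple `r`,
`de_fibre_card_le_sqrt_sum` + `de_linRatioEnergy_le` on each fibre (`W_Q(Z) ≤ W_Q(r)`),
Cauchy–Schwarz over `r` and `de_energy_sum_le` (`de_toolZ_assemble`). [folklore] -/
theorem de_dispersionToolZ : ∀ {d : ℕ} (i₀ i₁ : Fin d), (i₀ : ℕ) = 0 → (i₁ : ℕ) = 1 → ∀ {c₁ c₂ c₃ : ℕ}, 0 < c₁ → 0 < c₂ → 0 < c₃ → ∀ (X Y Z : Fin d → ℕ), (∀ j, 0 < X j) → (∀ j, 0 < Y j) → (∀ j, 0 < Z j) → ∀ {T Dτ : ℕ}, c₁ * shapeVal (fun j => 2 * X j) ≤ T → c₂ * shapeVal (fun j => 2 * Y j) ≤ T → c₃ * shapeVal (fun j => 2 * Z j) ≤ T → (∀ m : ℕ, m ≠ 0 → m ≤ 8 * T ^ 3 → m.divisors.card ≤ Dτ) → ∀ (Q : Finset (Fin d)), (shapeCount c₁ c₂ c₃ X Y Z : ℝ) ^ 2 ≤ 4400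 * (Dτ : ℝ) ^ (6 * d + 8) * ((X i₀ : ℝ) * Y i₀) * max 1 (((X i₀ : ℝ) * Y i₀) / ((onVal Q Z : ℕ) : ℝ)) * ((subBox Qᶜ Z).card : ℝ) * (((subBox Qᶜ Z).card : ℝ) * (((subBox ({i₀, i₁} : Finset (Fin d)) X).card : ℝ) * ((subBox ({i₀, i₁} : Finset (Fin d)) Y).card : ℝ)) ^ 2 * (4 * ((X i₁ : ℝ) * Y i₁)) ^ 2 / ((onVal Q Z : ℕ) : ℝ) + ((subBox Qᶜ Z).card : ℝ) * (((subBox ({i₀, i₁} : Finset (Fin d)) X).card : ℝ) * ((subBox ({i₀, i₁} : Finset (Fin d)) Y).card : ℝ)) ^ 2 + (4 * ((X i₁ : ℝ) * Y i₁)) * ((subBox Qᶜ Z).card : ℝ) * (((subBox ({i₀, i₁} : Finset (Fin d)) X).card : ℝ) * ((subBox ({i₀, i₁} : Finset (Fin d)) Y).card : ℝ)) + (4 * ((X i₁ : ℝ) * Y i₁)) * (((subBox ({i₀, i₁} : Finset (Fin d)) X).card : ℝ) * ((subBox ({i₀, i₁} : Finset (Fin d)) Y).card : ℝ)) ^ 2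 * Real.sqrt ((subBox Qᶜ Z).card : ℝ)) := by
  intro d i₀ i₁ h0 h1 c₁ c₂ c₃ hc₁ hc₂ hc₃ X Y Z hX hY hZ T Dτ hTX hTY hTZ hD Q
  -- `T ≥ 1` and the weak divisor hypothesis
  have hT0 : 0 < T := lt_of_lt_of_le
    (Nat.mul_pos hc₃ (prod_pos fun i _ => pow_pos (Nat.mul_pos two_pos (hZ i)) _)) hTZ
  have hT3 : T ≤ 8 * T ^ 3 :=
    (Nat.le_self_pow (by norm_num) T).trans (Nat.le_mul_of_pos_left _ (by norm_num))
  have hD' : ∀ m : ℕ, m ≠ 0 → m ≤ T → m.divisors.card ≤ Dτ := fun m hm hmT =>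
    hD m hm (hmT.trans hT3)
  have hTZ' : shapeVal (fun j => 2 * Z j) ≤ T := (Nat.le_mul_of_pos_left _ hc₃).trans hTZ
  -- `2 W_{i₀} ≤ T` for `W = X, Y`, hence `4 X₀ Y₀ ≤ T² ≤ 8 T³`
  have key : ∀ {c : ℕ} {W : Fin d → ℕ}, 0 < c → (∀ j, 0 < W j) →
      c * shapeVal (fun j => 2 * W j) ≤ T → 2 * W i₀ ≤ T := by
    intro c W hc hW hT
    have hpos : 0 < shapeVal (fun j => 2 * W j) :=
      prod_pos fun i _ => pow_pos (Nat.mul_pos two_pos (hW i)) _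
    have hdvd : (2 * W i₀) ^ ((i₀ : ℕ) + 1) ∣ shapeVal (fun j => 2 * W j) :=
      dvd_prod_of_mem (fun i => (2 * W i) ^ ((i : ℕ) + 1)) (mem_univ i₀)
    calc 2 * W i₀ = (2 * W i₀) ^ ((i₀ : ℕ) + 1) := by rw [h0, zero_add, pow_one]
      _ ≤ shapeVal (fun j => 2 * W j) := Nat.le_of_dvd hpos hdvd
      _ ≤ c * shapeVal (fun j => 2 * W j) := Nat.le_mul_of_pos_left _ hc
      _ ≤ T := hT
  have hDlin : ∀ m : ℕ, m ≠ 0 → m ≤ 4 * (X i₀ * Y i₀) → m.divisors.card ≤ Dτ := by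
    intro m hm hm4
    refine hD m hm (hm4.trans ?_)
    calc 4 * (X i₀ * Y i₀) = (2 * X i₀) * (2 * Y i₀) := by ring
      _ ≤ T * T := Nat.mul_le_mul (key hc₁ hX hTX) (key hc₂ hY hTY)
      _ = T ^ 2 * 1 := by ring
      _ ≤ T ^ 2 * T := Nat.mul_le_mul_left _ hT0
      _ = 1 * T ^ 3 := by ring
      _ ≤ 8 * T ^ 3 := Nat.mul_le_mul_right _ (by norm_num)
  -- the moduli `q(r) = W_Q(r) ≥ q₀ = W_Q(Z) > 0`
  have hq0 : 0 < onVal Q Z := prod_pos fun i _ => pow_pos (hZ i) _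
  have hq : ∀ r ∈ subBox Qᶜ Z, 0 < onVal Q r := fun r hr =>
    Nat.pos_of_ne_zero (de_onVal_ne_zero_and_le hZ hr).1
  -- the uniform bound `Ē` on the linear ratio energies
  have hM1 : (1 : ℝ) ≤ max 1 (((X i₀ : ℝ) * Y i₀) / ((onVal Q Z : ℕ) : ℝ)) := le_max_left _ _
  have hEbar : ∀ r ∈ subBox Qᶜ Z, (Dτ : ℝ) * (4 * ((X i₀ : ℝ) * Y i₀)) *
      (8 * ((X i₀ : ℝ) * Y i₀) / (onVal Q r : ℕ) + 3) ≤ (Dτ : ℝ) * (4 * ((X i₀ : ℝ) * Y i₀)) *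
        (11 * max 1 (((X i₀ : ℝ) * Y i₀) / ((onVal Q Z : ℕ) : ℝ))) := by
    intro r hr
    refine mul_le_mul_of_nonneg_left ?_ (by positivity)
    have hqq : ((onVal Q Z : ℕ) : ℝ) ≤ ((onVal Q r : ℕ) : ℝ) :=
      Nat.cast_le.mpr (de_onVal_corner_le hr)
    have hq0' : (0 : ℝ) < ((onVal Q Z : ℕ) : ℝ) := Nat.cast_pos.mpr hq0
    have h8 : 8 * ((X i₀ : ℝ) * Y i₀) / (onVal Q r : ℕ) ≤
        8 * max 1 (((X i₀ : ℝ) * Y i₀) / ((onVal Q Z : ℕ) : ℝ)) := by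
      rw [mul_div_assoc]
      refine mul_le_mul_of_nonneg_left ?_ (by norm_num)
      exact (div_le_div_of_nonneg_left (by positivity) hq0' hqq).trans (le_max_right _ _)
    linarith
  -- assembly
  refine (de_toolZ_assemble
    (de_energy_sum_le i₀ i₁ h0 h1 hc₁ hc₂ Z X Y hZ hX hY hTZ' hTX hTY hD Q)
    (de_shapeCount_le_fibre_hostZ hc₁ hc₂ hc₃ X Y Z hX hY hZ hTZ hD' Q)
    (de_toolZ_card_filter_prod_le _ _ _)
    (fun r hr => (de_fibre_card_le_sqrt_sum i₀ h0 (onVal Q r) c₁ c₂ (hq r hr) hc₁ hc₂ X Y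
      hX hY).trans (mul_le_mul_of_nonneg_right (Real.sqrt_le_sqrt
        ((de_linRatioEnergy_le (onVal Q r) (X i₀) (Y i₀) Dτ (hq r hr) hDlin).trans
          (hEbar r hr))) (Real.sqrt_nonneg _)))
    (fun _ _ => Nat.cast_nonneg _) (Nat.cast_nonneg _) (by positivity) (by positivity)).trans
    (le_of_eq ?_)
  ring

end Summit.ABC.ABC.Theorems.MazurKaneLaw
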